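import Literature.IUT.HodgeArakelov.ConstantMultipleRigidity
import Literature.IUT.HodgeArakelov.ZeroLabelSplitting

/-!
# [IUTchII] Cor 1.12 (ii): the theta evaluation and the splittings `(†μθ)(Π)` — PROOF companion

Proof-only companion (abc-iut cell, D-0067 discharge wave 4, seat abc-iut-w4-d043; DISCHARGE-L6 v1.6 row
F14-b; node **IUTchII:Cor1.12(ii)**) to the landed `ConstantMultipleRigidity.lean` (abc-iut-L6-t1, v2 p410537;
frozen, not edited) and to abc-iut-L6-d1's `ZeroLabelSplitting.lean` (p407386, the abstract mechanism). No
definitions.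

S. Mochizuki, *Inter-universal Teichmüller theory II*, kurims manuscript (Dec. 2020), Cor. 1.12 (ii) p. 57:
"restriction to the subgroup `D ⊆ Π_Ÿ(Π)` determines [the horizontal arrows in] a commutative diagram
`{M^×_TM·∞θ(Π)}^ι → M^×_TM(Π) (⊆ lim_J H¹(J,(l·Δ_Θ)(Π)))` … Here, the inverse images of the submodules of
torsion elements via the upper and lower horizontal arrows are given, respectively, by `∞θ(Π)^ι` and
`∞θ_env(M^Θ_*(Π))^ι`. In particular, we obtain a functorial algorithm … for constructing splittings
`M^{×μ}_TM(Π) × {∞θ(Π)^ι/M^μ_TM(Π)}` of `{M^×_TM·∞θ(Π)}^ι/M^μ_TM(Π)`"; printed proof (p. 58, verbatim):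
"Proof. Assertion (i) follows immediately from the discussion of Remark 1.4.1 and the references quoted in
this discussion. Assertion (ii) follows immediately from the structure of the objects under consideration,
as described in [EtTh], Proposition 1.5, (ii), (iii) [cf. also the proofs of [EtTh], Theorems 1.6, 1.10].
Finally, the multiradiality of assertion (iii) follows immediately from the characteristic nature of the
various torsion submodules “`M^μ_TM(−)`” that appear [cf. the discussion of Remark 1.10.2; the discussion of
Remark 1.12.2 below]." (v2 of this header: the v1 header carried a NON-verbatim rendering of this proof
sentence with the locator p. 57 — referee lane P #118, 2026-08-25; corrected here, Lean content unchanged.)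
Claim key `Mochizuki2012`, status DISPUTED (D-0012).

WHAT IS PROVED. The landed file types Cor. 1.12 (ii) as the `Prop`-valued structure `Cor112_ii Ev` over
theta-evaluation DATA `Ev : ThetaEvaluation T E I` (an axiom-free interface: the ambient module
`lim_J H¹(Π_Ÿ(Π)|_J,(l·Δ_Θ)(Π))`, the unit classes `M^×_TM(Π) ⊆ lim_J H¹(J,(l·Δ_Θ)(Π))` with their inclusion
`inclHd`, the restriction `resD` to the decomposition group `D`, the automorphism `iotaLim` by which the
pointed inversion `ι` acts). Here `Cor112_ii Ev` — ALL THREE CLAUSES (`res_mem`, `torsion_preimage`,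
`splitting`) — is DERIVED (`ThetaEvaluation.cor112_ii_of_inputs`) from the four printed inputs, stated as
hypotheses ON THE DATA (theorem binders, not new `Prop` facts):
* `(hD₁)`/`(hD₂)`  restriction to `D` of (the image of) a unit class is again a unit class, and detects
  torsion of unit classes — "one has a natural inclusion `M^×_TM(Π) ↪ lim_J H¹(J,(l·Δ_Θ)(Π))`" (Cor. 1.12 (c)
  p. 56; the Kummer classes of `O^×_k` live on `G_k` and `D ↠ G_k` is open: [AbsTopIII] Prop. 3.2, Kummer
  injectivity modulo torsion);
* `(hι)`  `ι` fixes the unit classes up to torsion — `ι` is an automorphism of `Ÿ` OVER `k`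
  (Rmk. 1.4.1 (ii) p. 28: "`ι_Ÿ` of `Ÿ̲_k` lifting `ι_X̲̲`"), so it acts trivially on classes pulled back
  from `G_k`;
* `(hθ)`  restriction to `D` kills `∞θ(Π)^ι` modulo torsion — THE CONTENT: the values at the `ι`-fixed
  decomposition groups `μ_-` of an étale theta function OF STANDARD TYPE are `2l`-th roots of unity
  ([EtTh] Prop. 1.4 (ii)/(iii), Def. 1.9, Thm. 1.10; the proof of (ii), p. 58, cites exactly "[EtTh],
  Proposition 1.5, (ii), (iii) [cf. also the proofs of [EtTh], Theorems 1.6, 1.10]", and Rmk. 1.4.1 (ii) p. 29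
  recalls: "an “étale theta function of standard type” is defined precisely by the condition that its
  restriction to `D_{μ_-}` be a `2l`-th root of unity");
* `(hμ)`  the torsion of `lim_J H¹(J,(l·Δ_Θ)(Π))` lies in `M^×_TM(Π)` — `μ(k̄) ⊆ O^×` (Cor. 1.12 (d) p. 56:
  "`M^μ_TM(−) ⊆ M^×_TM(−)` denotes the submodule of torsion elements").
These are exactly the inputs (1) `hS`, (2) `hM` of abc-iut-L6-d1's mechanism file (there stated for an
abstract `f : A →+ B`), completed by `(hι)`/`(hμ)`, which the typed clauses `res_mem` and the
`ι`-invariance bookkeeping of `Cor112_ii` additionally require; at the MODEL (DISCHARGE-L6 row F14-a,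
abc-iut-L6-t1: `CohomologySystem` instantiated from L2's `ContH1`) they become four lemmas about L2's
objects, and `cor112_ii_of_inputs` then yields `Cor112_ii` there with no further work. Nothing here asserts a
disputed claim or takes a side on [IUTchIII] Cor. 3.12; typed ≠ discharged for the inputs themselves.
-/

namespace Literature.IUT.HodgeArakelov

universe u

variable {S : ThetaSetting.{u}} {F : ModelFamily S} {Sys : MonoThetaProjSystem F}
variable {T : ThetaEnvData Sys} {E : EnvOfGroup S Sys.PiX} {I : PointedInversion E T.D}

/-! ### Torsion bookkeeping in the ambient module -/

/-- `∞θ(Π)` is stable under adding torsion classes: "some [positive integer] multiple … coincides, up to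
torsion, with an element of `θ(Π)`" (Prop. 1.4 p. 27). [claim: Mochizuki2012, status: disputed] (IUTchII §1 Prop 1.4, kurims p.27) -/
theorem EtaleThetaData.add_mem_thetaInfty_of_isOfFinAddOrder {P : TopGroup.{u}} (D : EtaleThetaData S P)
    {y t : D.coh.lim} (hy : IsOfFinAddOrder y) (ht : t ∈ D.thetaInfty) : y + t ∈ D.thetaInfty := by
  obtain ⟨n, hn, t₀, ht₀, htor⟩ := ht
  refine ⟨n, hn, t₀, ht₀, ?_⟩
  have : n • (y + t) - D.coh.toLim ⊤ t₀ = n • y + (n • t - D.coh.toLim ⊤ t₀) := by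
    rw [smul_add]; abel
  rw [this]
  exact (hy.nsmul (n := n)).add htor

namespace ThetaEvaluation

variable (Ev : ThetaEvaluation T E I)

/-- Membership in the `ι`-invariants for the action `Ev.iotaAct` INDUCED by the automorphism `Ev.iotaLim`:
`x ∈ X^ι ↔ x ∈ X ∧ (ι x - x)` is torsion (the landed `mem_iotaInvariants_iff`, specialised).
[claim: Mochizuki2012, status: disputed] (IUTchII §1 Cor 1.12 (i), kurims p.57) -/
theorem mem_iotaInvariants_iotaAct_iff (X : Set T.D.coh.lim) (x : T.D.coh.lim) :
    x ∈ iotaInvariants Ev.iotaAct X ↔ x ∈ X ∧ IsOfFinAddOrder (Ev.iotaLim x - x) :=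
  mem_iotaInvariants_iff Ev.iotaLim X x

/-- If `x = a + b` is `ι`-invariant up to torsion and so is `a`, then so is `b`.
[claim: Mochizuki2012, status: disputed] (IUTchII §1 Cor 1.12 (i), kurims p.57) -/
theorem isOfFinAddOrder_iota_sub_of_add {a b : T.D.coh.lim}
    (hab : IsOfFinAddOrder (Ev.iotaLim (a + b) - (a + b))) (ha : IsOfFinAddOrder (Ev.iotaLim a - a)) :
    IsOfFinAddOrder (Ev.iotaLim b - b) := by
  have : Ev.iotaLim b - b = (Ev.iotaLim (a + b) - (a + b)) - (Ev.iotaLim a - a) := by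
    rw [map_add]; abel
  rw [this]
  exact ThetaValueOrbits.isOfFinAddOrder_sub hab ha

/-! ### The four printed inputs, as hypotheses on the evaluation data

Stated as THEOREM BINDERS (no new `Prop` declarations, D-0067 (1)):
* `(hD₁)` `∀ m ∈ M^×_TM, res_D (incl m) ∈ M^×_TM` and `(hD₂)` `res_D (incl m)` torsion `→ m` torsion —
  "natural inclusion `M^×_TM(Π) ↪ lim_J H¹(J,(l·Δ_Θ)(Π))`" (Cor. 1.12 (c) p. 56; Kummer injectivity modulo
  torsion, [AbsTopIII] Prop. 3.2);
* `(hι)` `∀ m ∈ M^×_TM`, `ι (incl m) - incl m` torsion — `ι_Ÿ` lies over `k` (Rmk. 1.4.1 (ii) p. 28);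
* `(hθ)` `∀ t ∈ ∞θ(Π)^ι`, `res_D t` torsion — THE CONTENT ([EtTh] Prop. 1.4 (ii)/(iii), Def. 1.9, Thm. 1.10;
  proof of (ii), p. 58: "[EtTh], Proposition 1.5, (ii), (iii) [cf. also the proofs of [EtTh], Theorems 1.6,
  1.10]"; Rmk. 1.4.1 (ii) p. 29: "its restriction to `D_{μ_-}` be a `2l`-th root of unity");
* `(hμ)` every torsion class of `lim_J H¹(J,(l·Δ_Θ)(Π))` lies in `M^×_TM(Π)` (`μ(k̄) ⊆ O^×`; Cor. 1.12 (d)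
  p. 56: "`M^μ_TM(−) ⊆ M^×_TM(−)` denotes the submodule of torsion elements"). -/

variable {Ev}

/-! ### Consequences -/

/-- Under `(hι)`: an element of `M^×_TM·∞θ(Π)` that is `ι`-invariant up to torsion decomposes as
`inclHd m + t` with `m ∈ M^×_TM(Π)` and `t ∈ ∞θ(Π)^ι` (the theta part is itself `ι`-invariant).
[claim: Mochizuki2012, status: disputed] (IUTchII §1 Cor 1.12 (ii), kurims p.57) -/
theorem exists_decomp_of_mem_iotaInvariants_MxTheta
    (hι : ∀ m ∈ Ev.MxTM, IsOfFinAddOrder (Ev.iotaLim (Ev.inclHd m) - Ev.inclHd m))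
    {x : T.D.coh.lim} (hx : x ∈ iotaInvariants Ev.iotaAct Ev.MxTheta) :
    ∃ m ∈ Ev.MxTM, ∃ t ∈ iotaInvariants Ev.iotaAct T.D.thetaInfty, x = Ev.inclHd m + t := by
  rw [mem_iotaInvariants_iotaAct_iff] at hx
  obtain ⟨hxmem, hxι⟩ := hx
  obtain ⟨a, ⟨m, hm, rfl⟩, t, ht, rfl⟩ := hxmem
  refine ⟨m, hm, t, ?_, rfl⟩
  rw [mem_iotaInvariants_iotaAct_iff]
  exact ⟨ht, Ev.isOfFinAddOrder_iota_sub_of_add hxι (hι m hm)⟩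

/-- Under `(hι)`: conversely `inclHd m + t ∈ {M^×_TM·∞θ(Π)}^ι` for `m ∈ M^×_TM(Π)`, `t ∈ ∞θ(Π)^ι`.
[claim: Mochizuki2012, status: disputed] (IUTchII §1 Cor 1.12 (ii), kurims p.57) -/
theorem add_mem_iotaInvariants_MxTheta
    (hι : ∀ m ∈ Ev.MxTM, IsOfFinAddOrder (Ev.iotaLim (Ev.inclHd m) - Ev.inclHd m))
    {m : Ev.Hd} (hm : m ∈ Ev.MxTM) {t : T.D.coh.lim} (ht : t ∈ iotaInvariants Ev.iotaAct T.D.thetaInfty) :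
    Ev.inclHd m + t ∈ iotaInvariants Ev.iotaAct Ev.MxTheta := by
  rw [mem_iotaInvariants_iotaAct_iff] at ht ⊢
  refine ⟨⟨Ev.inclHd m, ⟨m, hm, rfl⟩, t, ht.1, rfl⟩, ?_⟩
  have : Ev.iotaLim (Ev.inclHd m + t) - (Ev.inclHd m + t) =
      (Ev.iotaLim (Ev.inclHd m) - Ev.inclHd m) + (Ev.iotaLim t - t) := by
    rw [map_add]; abel
  rw [this]
  exact (hι m hm).add ht.2

/-- Clause `res_mem` of Cor. 1.12 (ii) from the inputs: restriction to `D` maps `{M^×_TM·∞θ(Π)}^ι` into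
`M^×_TM(Π)`. [claim: Mochizuki2012, status: disputed] (IUTchII §1 Cor 1.12 (ii), kurims p.57) -/
theorem resD_mem_MxTM_of_inputs (hD₁ : ∀ m ∈ Ev.MxTM, Ev.resD (Ev.inclHd m) ∈ Ev.MxTM)
    (hι : ∀ m ∈ Ev.MxTM, IsOfFinAddOrder (Ev.iotaLim (Ev.inclHd m) - Ev.inclHd m))
    (hθ : ∀ t ∈ iotaInvariants Ev.iotaAct T.D.thetaInfty, IsOfFinAddOrder (Ev.resD t))
    (hμ : ∀ y : Ev.Hd, IsOfFinAddOrder y → y ∈ Ev.MxTM)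
    {x : T.D.coh.lim} (hx : x ∈ iotaInvariants Ev.iotaAct Ev.MxTheta) : Ev.resD x ∈ Ev.MxTM := by
  obtain ⟨m, hm, t, ht, rfl⟩ := exists_decomp_of_mem_iotaInvariants_MxTheta hι hx
  rw [map_add]
  exact Ev.MxTM.add_mem (hD₁ m hm) (hμ _ (hθ t ht))

/-- Clause `torsion_preimage` of Cor. 1.12 (ii) from the inputs: on `{M^×_TM·∞θ(Π)}^ι`, the restriction to `D`
is torsion iff the element lies in `∞θ(Π)^ι` ("the inverse images of the submodules of torsion elements …
are given by `∞θ(Π)^ι`"). [claim: Mochizuki2012, status: disputed] (IUTchII §1 Cor 1.12 (ii), kurims p.57) -/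
theorem isOfFinAddOrder_resD_iff_of_inputs
    (hD₂ : ∀ m ∈ Ev.MxTM, IsOfFinAddOrder (Ev.resD (Ev.inclHd m)) → IsOfFinAddOrder m)
    (hι : ∀ m ∈ Ev.MxTM, IsOfFinAddOrder (Ev.iotaLim (Ev.inclHd m) - Ev.inclHd m))
    (hθ : ∀ t ∈ iotaInvariants Ev.iotaAct T.D.thetaInfty, IsOfFinAddOrder (Ev.resD t))
    {x : T.D.coh.lim} (hx : x ∈ iotaInvariants Ev.iotaAct Ev.MxTheta) :
    IsOfFinAddOrder (Ev.resD x) ↔ x ∈ iotaInvariants Ev.iotaAct T.D.thetaInfty := by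
  refine ⟨fun h => ?_, fun h => hθ x h⟩
  have hxι := ((Ev.mem_iotaInvariants_iotaAct_iff _ _).mp hx).2
  obtain ⟨m, hm, t, ht, rfl⟩ := exists_decomp_of_mem_iotaInvariants_MxTheta hι hx
  have ht' := (Ev.mem_iotaInvariants_iotaAct_iff _ _).mp ht
  -- the unit part is torsion: `res_D(m) = res_D(x) - res_D(t)` with both terms torsion
  have hm_tor : IsOfFinAddOrder m := by
    refine hD₂ m hm ?_
    have : Ev.resD (Ev.inclHd m) = Ev.resD (Ev.inclHd m + t) - Ev.resD t := by
      rw [map_add, add_sub_cancel_right]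
    rw [this]
    exact ThetaValueOrbits.isOfFinAddOrder_sub h (hθ t ht)
  rw [mem_iotaInvariants_iotaAct_iff]
  exact ⟨T.D.add_mem_thetaInfty_of_isOfFinAddOrder (Ev.inclHd.isOfFinAddOrder hm_tor) ht'.1, hxι⟩

/-- Clause `splitting` of Cor. 1.12 (ii) from the inputs, UNIQUENESS half: two decompositions
`inclHd m + t ≡ inclHd m' + t'` modulo torsion (`m, m' ∈ M^×_TM`, `t, t' ∈ ∞θ^ι`) have torsion-congruent
components — the splitting `M^{×μ}_TM(Π) × {∞θ(Π)^ι/M^μ_TM(Π)}` is well defined.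
[claim: Mochizuki2012, status: disputed] (IUTchII §1 Cor 1.12 (ii), kurims p.57) -/
theorem decomp_unique_of_inputs
    (hD₂ : ∀ m ∈ Ev.MxTM, IsOfFinAddOrder (Ev.resD (Ev.inclHd m)) → IsOfFinAddOrder m)
    (hθ : ∀ t ∈ iotaInvariants Ev.iotaAct T.D.thetaInfty, IsOfFinAddOrder (Ev.resD t))
    {m m' : Ev.Hd} (hm : m ∈ Ev.MxTM) (hm' : m' ∈ Ev.MxTM)
    {t t' : T.D.coh.lim} (ht : t ∈ iotaInvariants Ev.iotaAct T.D.thetaInfty)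
    (ht' : t' ∈ iotaInvariants Ev.iotaAct T.D.thetaInfty)
    (h : IsOfFinAddOrder ((Ev.inclHd m + t) - (Ev.inclHd m' + t'))) :
    IsOfFinAddOrder (Ev.inclHd m - Ev.inclHd m') ∧ IsOfFinAddOrder (t - t') := by
  -- apply `res_D`: the theta parts die modulo torsion, so `res_D(m - m')` is torsion, hence `m - m'` is
  have hres : IsOfFinAddOrder (Ev.resD (Ev.inclHd (m - m'))) := by
    have : Ev.resD (Ev.inclHd (m - m')) =
        Ev.resD ((Ev.inclHd m + t) - (Ev.inclHd m' + t')) - (Ev.resD t - Ev.resD t') := by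
      simp only [map_sub, map_add]; abel
    rw [this]
    exact ThetaValueOrbits.isOfFinAddOrder_sub (Ev.resD.isOfFinAddOrder h)
      (ThetaValueOrbits.isOfFinAddOrder_sub (hθ t ht) (hθ t' ht'))
  have hmm : IsOfFinAddOrder (Ev.inclHd m - Ev.inclHd m') := by
    rw [← map_sub]
    exact Ev.inclHd.isOfFinAddOrder (hD₂ _ (Ev.MxTM.sub_mem hm hm') hres)
  refine ⟨hmm, ?_⟩
  have : t - t' = ((Ev.inclHd m + t) - (Ev.inclHd m' + t')) - (Ev.inclHd m - Ev.inclHd m') := by abel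
  rw [this]
  exact ThetaValueOrbits.isOfFinAddOrder_sub h hmm

/-- **IUTchII:Cor1.12(ii)** (kurims p. 57) DISCHARGED modulo its four printed inputs: for theta-evaluation data
`Ev` satisfying `(hD₁)`/`(hD₂)` unit classes restrict to unit classes, faithfully modulo torsion; `(hι)` `ι` fixes unit
classes up to torsion; `(hθ)` `∞θ(Π)^ι` restricts to torsion on `D`; `(hμ)` torsion classes are unit classes —
the typed statement `Cor112_ii Ev` holds: restriction to `D` maps `{M^×_TM·∞θ(Π)}^ι → M^×_TM(Π)`, the inverse
image of the torsion is `∞θ(Π)^ι`, and the splitting `(†μθ)(Π)` exists and is unique modulo torsion.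
[claim: Mochizuki2012, status: disputed] (IUTchII §1 Cor 1.12 (ii), kurims p.57) -/
theorem cor112_ii_of_inputs (hD₁ : ∀ m ∈ Ev.MxTM, Ev.resD (Ev.inclHd m) ∈ Ev.MxTM)
    (hD₂ : ∀ m ∈ Ev.MxTM, IsOfFinAddOrder (Ev.resD (Ev.inclHd m)) → IsOfFinAddOrder m)
    (hι : ∀ m ∈ Ev.MxTM, IsOfFinAddOrder (Ev.iotaLim (Ev.inclHd m) - Ev.inclHd m))
    (hθ : ∀ t ∈ iotaInvariants Ev.iotaAct T.D.thetaInfty, IsOfFinAddOrder (Ev.resD t))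
    (hμ : ∀ y : Ev.Hd, IsOfFinAddOrder y → y ∈ Ev.MxTM) :
    Literature.IUT.HodgeArakelov.Cor112_ii Ev where
  res_mem x hx := resD_mem_MxTM_of_inputs hD₁ hι hθ hμ hx
  torsion_preimage x hx := isOfFinAddOrder_resD_iff_of_inputs hD₂ hι hθ hx
  splitting x hx := by
    obtain ⟨m, hm, t, ht, rfl⟩ := exists_decomp_of_mem_iotaInvariants_MxTheta hι hx
    refine ⟨m, hm, t, ht, rfl, fun m' hm' t' ht' hq => ?_⟩
    rw [QuotientAddGroup.eq_iff_sub_mem, AddCommGroup.mem_torsion] at hq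
    obtain ⟨h1, h2⟩ := decomp_unique_of_inputs hD₂ hθ hm hm' ht ht' hq
    constructor
    · rw [QuotientAddGroup.eq_iff_sub_mem, AddCommGroup.mem_torsion, ← neg_sub]
      exact h1.neg
    · rw [QuotientAddGroup.eq_iff_sub_mem, AddCommGroup.mem_torsion, ← neg_sub]
      exact h2.neg

/-! ### The content hypothesis is necessary -/

/-- `∞θ(Π)^ι ⊆ {M^×_TM·∞θ(Π)}^ι` (take the trivial unit class). [claim: Mochizuki2012, status: disputed] (IUTchII §1 Cor 1.12 (ii), kurims p.57) -/
theorem iotaInvariants_thetaInfty_subset :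
    iotaInvariants Ev.iotaAct T.D.thetaInfty ⊆ iotaInvariants Ev.iotaAct Ev.MxTheta := by
  intro t ht
  rw [mem_iotaInvariants_iotaAct_iff] at ht ⊢
  exact ⟨⟨Ev.inclHd 0, ⟨0, Ev.MxTM.zero_mem, rfl⟩, t, ht.1, by simp⟩, ht.2⟩

/-- CONVERSELY, the typed `Cor112_ii Ev` IMPLIES the content input `(hθ)`: restriction to `D` kills `∞θ(Π)^ι`
modulo torsion (clause `torsion_preimage` at the elements of `∞θ(Π)^ι` themselves) — so `(hθ)` is exactly the
part of Cor. 1.12 (ii) that rests on [EtTh] (Prop. 1.4 (ii)/(iii), Thm. 1.10), not an artefact of this file.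
[claim: Mochizuki2012, status: disputed] (IUTchII §1 Cor 1.12 (ii), kurims p.57) -/
theorem thetaValuesTorsion_of_cor112_ii (h : Literature.IUT.HodgeArakelov.Cor112_ii Ev)
    {t : T.D.coh.lim} (ht : t ∈ iotaInvariants Ev.iotaAct T.D.thetaInfty) : IsOfFinAddOrder (Ev.resD t) :=
  (h.torsion_preimage t (Ev.iotaInvariants_thetaInfty_subset ht)).mpr ht

/-- … and the typed `Cor112_ii Ev` implies that `∞θ(Π)^ι` restricts INTO `M^×_TM(Π)` (clause `res_mem`), the
`(hμ)`-flavoured part. [claim: Mochizuki2012, status: disputed] (IUTchII §1 Cor 1.12 (ii), kurims p.57) -/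
theorem resD_thetaInfty_mem_of_cor112_ii (h : Literature.IUT.HodgeArakelov.Cor112_ii Ev)
    {t : T.D.coh.lim} (ht : t ∈ iotaInvariants Ev.iotaAct T.D.thetaInfty) : Ev.resD t ∈ Ev.MxTM :=
  h.res_mem t (Ev.iotaInvariants_thetaInfty_subset ht)

/-! ### Reduction of the content input to the classes `θ(Π)` themselves -/

/-- REDUCTION of `(hθ)` to the theta classes `θ(Π) ⊆ H¹(Π_Ÿ(Π),(l·Δ_Θ)(Π))` (independent derivation by
abc-iut-w4-d041, lifted from its staged cross-check with its consent, STATUS 2026-08-25T23:22:13Z): if every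
class `t ∈ θ(Π)` that is `ι`-invariant up to torsion restricts to a torsion element on `D` ("its restriction to
`D_{μ_-}` be a `2l`-th root of unity", kurims p. 29; [EtTh] Def. 1.9, Thm. 1.10 — standard type), then so does
every element of `∞θ(Π)^ι` (p. 27: "some [positive integer] multiple … coincides, up to torsion, with an
element of `θ(Π)`"; the bracket is print's own). [claim: Mochizuki2012, status: disputed] (IUTchII §1 Cor 1.12 (ii), kurims p.57) -/
theorem resD_isOfFinAddOrder_of_theta
    (hθ₀ : ∀ t ∈ T.D.theta, IsOfFinAddOrder (Ev.iotaLim (T.D.coh.toLim ⊤ t) - T.D.coh.toLim ⊤ t) →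
      IsOfFinAddOrder (Ev.resD (T.D.coh.toLim ⊤ t)))
    {x : T.D.coh.lim} (hx : x ∈ iotaInvariants Ev.iotaAct T.D.thetaInfty) :
    IsOfFinAddOrder (Ev.resD x) := by
  rw [mem_iotaInvariants_iotaAct_iff] at hx
  obtain ⟨⟨n, hn, t, ht, htor⟩, hxι⟩ := hx
  -- `toLim t = n • x - u` with `u := n • x - toLim t` torsion, so `toLim t` is `ι`-invariant up to torsion
  have hιt : IsOfFinAddOrder (Ev.iotaLim (T.D.coh.toLim ⊤ t) - T.D.coh.toLim ⊤ t) := by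
    have h : Ev.iotaLim (T.D.coh.toLim ⊤ t) - T.D.coh.toLim ⊤ t =
        n • (Ev.iotaLim x - x) -
          (Ev.iotaLim (n • x - T.D.coh.toLim ⊤ t) - (n • x - T.D.coh.toLim ⊤ t)) := by
      rw [map_sub, map_nsmul, smul_sub]; abel
    rw [h]
    exact ThetaValueOrbits.isOfFinAddOrder_sub hxι.nsmul
      (ThetaValueOrbits.isOfFinAddOrder_sub (Ev.iotaLim.toAddMonoidHom.isOfFinAddOrder htor) htor)
  have hrest : IsOfFinAddOrder (Ev.resD (T.D.coh.toLim ⊤ t)) := hθ₀ t ht hιt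
  -- hence `n • res_D x = res_D (toLim t) + res_D u` is torsion, and so is `res_D x` (`n > 0`)
  have hn' : IsOfFinAddOrder (n • Ev.resD x) := by
    have h : n • Ev.resD x = Ev.resD (T.D.coh.toLim ⊤ t) + Ev.resD (n • x - T.D.coh.toLim ⊤ t) := by
      rw [← map_nsmul, ← map_add]; congr 1; abel
    rw [h]
    exact hrest.add (Ev.resD.isOfFinAddOrder htor)
  exact hn'.of_nsmul (Nat.pos_iff_ne_zero.mp hn)

/-- **IUTchII:Cor1.12(ii)** (kurims p. 57) from the printed inputs with the content input AT THE LEVEL OF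
`θ(Π)`: as `cor112_ii_of_inputs`, with `(hθ)` replaced by `(hθ₀)` "every `ι`-invariant-up-to-torsion class of
`θ(Π)` restricts to torsion on `D`" (the standard-type normalisation at `μ_-`, [EtTh] Def. 1.9 / Thm. 1.10).
[claim: Mochizuki2012, status: disputed] (IUTchII §1 Cor 1.12 (ii), kurims p.57) -/
theorem cor112_ii_of_inputs_theta (hD₁ : ∀ m ∈ Ev.MxTM, Ev.resD (Ev.inclHd m) ∈ Ev.MxTM)
    (hD₂ : ∀ m ∈ Ev.MxTM, IsOfFinAddOrder (Ev.resD (Ev.inclHd m)) → IsOfFinAddOrder m)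
    (hι : ∀ m ∈ Ev.MxTM, IsOfFinAddOrder (Ev.iotaLim (Ev.inclHd m) - Ev.inclHd m))
    (hθ₀ : ∀ t ∈ T.D.theta, IsOfFinAddOrder (Ev.iotaLim (T.D.coh.toLim ⊤ t) - T.D.coh.toLim ⊤ t) →
      IsOfFinAddOrder (Ev.resD (T.D.coh.toLim ⊤ t)))
    (hμ : ∀ y : Ev.Hd, IsOfFinAddOrder y → y ∈ Ev.MxTM) :
    Literature.IUT.HodgeArakelov.Cor112_ii Ev :=
  cor112_ii_of_inputs hD₁ hD₂ hι (fun _ hx => Ev.resD_isOfFinAddOrder_of_theta hθ₀ hx) hμ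

end ThetaEvaluation

end Literature.IUT.HodgeArakelov
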